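import Literature.Probability.Percolation.MarkedLoopTripodBasis
import Literature.Probability.Percolation.MarkedLoopRotation
import HarnessLib

/-!
# The basis of the tripod-law solution space adapted to every cut: boundary values on ALL arcs

Topic `Literature/Probability/Percolation`; generic-`k` layer, sequel to `MarkedLoopTripodBasis.lean` («TRIPOD-SOLVED»: ALL solutions of
Khristoforov–Smirnov's tripod law — the depth recursion with free data on the OUTERMOST patterns `Pat₀ k ≃ NCMatching (k+1)`, the basis
`basisW q`, the arc law `encl_iff_encl_gap_of_boundary`, the HOME-ARC count law `obsW_basis_boundary_last`, the pattern-count expansion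
`obsW_classWt_eq_sum_patternCount` and its support `patternCount_eq_zero_of_boundary`) and to `MarkedLoopRotation.lean` (cyclic symmetries
`IsCyc`, the rotation `rot k`, `relMap`, `rotW`, ★ `tripodLaw_rotW_iff` — the tripod law is invariant under cyclic symmetries of the marks;
`obsW_rotate` — rotating the domain is rotating the weight). `MarkedLoopTripodBasis` singles out the HOME arc `A_{k−1}` (from `u_{k−1}` to `u_0`):
there the surviving patterns are the outermost ones and the basis observables are COUNTS. This file removes the asymmetry: the solution space is
rotation-stable, EVERY arc `A_a` has its own adapted basis whose observables are counts on `A_a`, and the two bases differ by an explicitly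
invertible «change of cut».

## Content (every `k`; Parts 1–3 pure combinatorics, Parts 4–5 on `k`-marked domains)
* Part 1 — TRANSPORT OF PATTERNS AND SOLUTIONS: ★ `IsPattern.map` / `isPattern_map_iff` (patterns are transported by cyclic symmetries),
  `patMap σ hσ : Pat k ≃ Pat k`, `classWt_comp_patMap` (`classWt (w ∘ σ) = σ·classWt w`), `mem_solW_iff_tripodLaw_classWt`,
  ★★ `comp_patMap_mem_solW_iff` — THE SOLUTION SPACE `solW k` IS STABLE UNDER CYCLIC SYMMETRIES, `solWRot` (the linear automorphism).
* Part 2 — CUTS: `InArc c d x`, `GapInArc c d a` (the arc `A_a` inside the chord), ★ `CutCompat a p` — the pattern `p` is COMPATIBLE WITH THE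
  CUT at `a` (each chord has the partner and `A_a` on the same side: the `(k+1)`-point link pattern with `z ∈ A_a` is non-crossing);
  `cutCompat_iff_lt` (the one-car's arc-law shape `c < j < d ↔ c ≤ a < d`), ★ `cutCompat_iff_pdepth_eq_zero` (home arc = outermost),
  ★ `cutCompat_patMap_iff` (compatibility is transported), `outAt a` (finset), `cutShift a = rot^(a+1)` / `cutShift_apply_last`, `unshift`,
  ★ `cutCompat_iff_pdepth_unshift`, `outAtEquiv a : outAt a ≃ Pat₀ k`, ★ `card_outAt` / `card_outAt_eq_card_ncMatching`
  (`#outAt a = #Pat₀ k = #NCMatching (k+1)` for EVERY cut), ★ `eq_of_mem_solW_of_cutCompat` (uniqueness from any cut).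
* Part 3 — ★★ THE ADAPTED BASIS `basisWAt a q` (`= basisW (unshift q) ∘ shift⁻¹`; zero if `q` is not compatible): `basisWAt_mem_solW`,
  `holomorphicW_basisWAt`, ★★ `basisWAt_apply_of_cutCompat` (`= δ` on the compatible patterns), ★★★ `eq_sum_basisWAt_of_mem_solW`
  (EVERY SOLUTION IS `Σ_{q ∈ outAt a} w q · basisWAt a q`: the values on the patterns compatible with ANY ONE cut are free and determine the
  solution), `finrank_solW_eq_card_outAt`, ★ `basisWAt_last` (home arc: `basisWAt (k−1) q = basisW q`), ★★ CHANGE OF CUT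
  `basisW_eq_sum_basisWAt` / `basisWAt_eq_sum_basisW` and the mutually inverse matrices `sum_basisW_mul_basisWAt` / `sum_basisWAt_mul_basisW`
  (entries of `(basisW q p)` are `0` or signed powers of `τ` by the one-car's `basisW_eq_zero_or_coefN`).
* Part 4 — ★★ BOUNDARY VALUES ON EVERY ARC: `cutCompat_of_boundary` (on `A_a` the pattern of every configuration is compatible with the cut
  at `a`), ★★ `obsW_classWt_eq_sum_outAt` (`ObsW D (classWt w) v i = Σ_{p ∈ outAt a} w p · N_p(z)` at `z ∈ A_a`), `obsW_eq_sum_outAt`,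
  ★★★ `obsW_basisWAt_boundary` — ON ITS OWN ARC THE ADAPTED BASIS OBSERVABLE IS THE COUNT `N_q(z)` (for every arc a basis of the solution
  space by observables that are link-pattern counts there), ★★ `obsW_basisW_boundary` — the home basis on every arc:
  `Σ_{p ∈ outAt a} basisW q p · N_p(z)`, i.e. with `holomorphicW_basisW` the complete discrete Riemann–Hilbert datum of each of the
  `#NCMatching (k+1)` basis observables (holomorphic inside; on each of the `k` arcs a fixed `{0, ±τ^m}`-combination of compatible pattern
  counts); `obsW_eq_sum_basisWAt` (every tripod-law observable in the adapted basis observables, at every admissible edge).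
* Part 4′ — ★★ EQUIVARIANCE: `outAt_map` (`σ (outAt a) = outAt (σ a)`), ★★ `basisWAt_equivariant` (`basisWAt (σ a) (σ q) (σ p) = basisWAt a q p`
  for EVERY cyclic `σ` — the adapted bases are intrinsic to the cyclically ordered marks), `basisWAt_comp_patMap_symm`, `basisWAt_comp_cutShift`
  (every adapted basis is a shifted home basis).
* Part 5 — `obsW_rotate_classWt` (`k ≥ 2`): the observable of a pattern weight `w` on the rotated domain is the observable of `w ∘ rot⁻¹`;
  ★★ `obsW_rotate_basisWAt`: `ObsW D.rotate (classWt (basisWAt a q)) = ObsW D (classWt (basisWAt (rot a) (rot q)))` — the adapted basis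
  observables of the rotated domain are those of `D` one cut on, matching the tree's `rotate_stretch` (`D.rotate.stretch a = D.stretch (a+1)`).

Not claimed: any statement about VALUES of the counts `N_p(z)` (percolation crossing probabilities — the dictionary is typed at `k = 3, 4, 5`
only), any boundary-value PROBLEM / uniqueness statement for discrete holomorphic functions, any continuum limit. The lane's exact tables
(`numerics/cuts_face.py`, k = 3, 5, 7, 9): rotation-stability, `#outAt c = C_{l+1}` for every cut, the adapted bases, and the mutually inverse
change-of-cut matrices (entries in `{0, ±1, ±τ, ±τ²}`, a signed permutation only for the home cut) — 0 violations; consistent with Parts 1–4.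

## References
* M. Khristoforov, S. Smirnov, *Percolation and O(1) loop model*, arXiv:2111.15612 (2021), §1.2 (arXiv v1 p. 2: `k` disorders, marked points
  «go in the counterclockwise order and are indexed cyclically», «IP(ξ) is a union of disjoint paths, matching marked points»), §2
  Definition 3 and Lemma 4 with its proof and Fig. 3 (p. 4), eq. (4) and Remark 6 (p. 5: boundary values `F(z) ∈ [τ^{j−1}, τ^{j+1}]` for
  `z ∈ u_{j−1}u_{j+1}`), §3 (pp. 5–7: the boundary-value problem at `k = 3`).
* B. Bollobás, O. Riordan, *Percolation*, CUP (2006), Ch. 7 §7.2.2 (pp. 191–195: marked discrete domains and their arcs), §7.2.3 p. 197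
  (re-marking by relabelling; verbatim «follow by relabelling the domain», §7.2.4, proof of Lemma 13).

## Mathlib / tree
Mathlib: `Finset.mem_map_equiv`, `Equiv.sum_comp`, `Fintype.card_coe`, `Fintype.card_congr`, `Submodule.sum_mem`, `Finset.sum_subset`,
`Finset.sum_eq_single_of_mem`. Tree: `MarkedLoopTripodBasis` (`IsPattern`, `Pat`, `Pat₀`, `solW`, `basisW`, `basisW_of_zero`, `eq_of_mem_solW`,
`eq_sum_basisW_of_mem_solW`, `classWt`, `restrictW_classWt`, `tripodLaw_iff_restrict_mem_solW`, `holomorphicW_classWt`, `depth_eq_zero_iff`,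
`card_pat₀_eq_card_ncMatching`, `encl_iff_encl_gap_of_boundary`, `isPattern_linkRel`, `patternCount`, `obsW_classWt_eq_sum_patternCount`,
`patternCount_eq_zero_of_boundary`, `obsW_classWt_restrictW`, `obsWLin`, `classWtLin`), `MarkedLoopRotation` (`IsCyc`, `IsCyc.symm`, `IsCyc.quad`,
`rot`, `isCyc_rot`, `isCyc_rot_pow`, `val_rot_pow`, `relMap`, `mem_relMap`, `mem_relMap'`, `mem_relMap_apply`, `relMap_symm_relMap`,
`relMap_relMap_symm`, `rotW`, `tripodLaw_rotW_iff`, `obsW_rotate`), `MarkedLoopHolomorphy` (`CcwTriple`, `TripodLaw`, `linkRel`, `ObsW`,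
`HolomorphicW`), `MarkedLoopTripodRank` (`depth`).
-/

open Finset

namespace Literature.Probability.Percolation.MarkedLoops

open Literature.Probability.Percolation.FivePoint (tau)

/-! ### Transport of patterns and of the solution space along a cyclic symmetry -/

section Transport

variable {nm : ℕ}

/-- ★ **patterns are transported by cyclic symmetries.** [cite: KhristoforovSmirnov2021, §1.2 (arXiv v1 p. 2: the link pattern)] -/
theorem IsPattern.map {σ : Equiv.Perm (Fin nm)} (hσ : IsCyc σ) {j : Fin nm} {L : Finset (Fin nm × Fin nm)} (h : IsPattern j L) :
    IsPattern (σ j) (relMap σ L) where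
  symm a b hab := by rw [mem_relMap] at hab ⊢; exact h.symm _ _ hab
  irrefl a haa := h.irrefl _ (mem_relMap.1 haa)
  off a b hab e := by
    rw [mem_relMap] at hab
    exact h.off _ _ hab (by rw [e, Equiv.symm_apply_apply])
  perfect a ha := by
    have ha' : σ.symm a ≠ j := fun e => ha (by rw [← e, Equiv.apply_symm_apply])
    obtain ⟨b, hb, huniq⟩ := h.perfect _ ha'
    refine ⟨σ b, mem_relMap.2 (by rw [Equiv.symm_apply_apply]; exact hb), fun b' hb' => ?_⟩
    have hb'' : (a, b') ∈ relMap σ _ := hb'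
    rw [mem_relMap] at hb''
    rw [← huniq _ hb'', Equiv.apply_symm_apply]
  planar x y z w hxz hyw := by
    rw [mem_relMap] at hxz hyw
    have key := h.planar _ _ _ _ hxz hyw
    rwa [← hσ.symm.quad x y z w]

/-- patterns are transported EQUIVALENTLY. [cite: KhristoforovSmirnov2021, §1.2 (arXiv v1 p. 2)] -/
theorem isPattern_map_iff {σ : Equiv.Perm (Fin nm)} (hσ : IsCyc σ) {j : Fin nm} {L : Finset (Fin nm × Fin nm)} :
    IsPattern (σ j) (relMap σ L) ↔ IsPattern j L := by
  refine ⟨fun h => ?_, fun h => h.map hσ⟩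
  have key := h.map hσ.symm
  rwa [Equiv.symm_apply_apply, relMap_symm_relMap] at key

/-- ★ **the action of a cyclic symmetry on the patterns** (a permutation of `Pat k`). [cite: KhristoforovSmirnov2021, §1.2 (arXiv v1 p. 2)] -/
def patMap (σ : Equiv.Perm (Fin nm)) (hσ : IsCyc σ) : Pat nm ≃ Pat nm where
  toFun p := ⟨(σ p.1.1, relMap σ p.1.2), p.2.map hσ⟩
  invFun p := ⟨(σ.symm p.1.1, relMap σ.symm p.1.2), p.2.map hσ.symm⟩
  left_inv _ := Subtype.ext (Prod.ext (σ.symm_apply_apply _) (relMap_symm_relMap σ _))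
  right_inv _ := Subtype.ext (Prod.ext (σ.apply_symm_apply _) (relMap_relMap_symm σ _))

/-- the underlying pair of a transported pattern. [cite: KhristoforovSmirnov2021, §1.2 (arXiv v1 p. 2)] -/
theorem patMap_val (σ : Equiv.Perm (Fin nm)) (hσ : IsCyc σ) (p : Pat nm) : (patMap σ hσ p).1 = (σ p.1.1, relMap σ p.1.2) := rfl

/-- the inverse action is the action of the inverse. [cite: KhristoforovSmirnov2021, §1.2 (arXiv v1 p. 2: counterclockwise cyclic indexing)] -/
theorem patMap_symm (σ : Equiv.Perm (Fin nm)) (hσ : IsCyc σ) : (patMap σ hσ).symm = patMap σ.symm hσ.symm := rfl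

/-- **transporting a pattern weight is transporting its class weight.** [cite: KhristoforovSmirnov2021, §2 Definition 3 and Lemma 4 (arXiv v1 p. 4)] -/
theorem classWt_comp_patMap (σ : Equiv.Perm (Fin nm)) (hσ : IsCyc σ) (w : Pat nm → ℂ) :
    classWt (w ∘ patMap σ hσ) = rotW σ (classWt w) := by
  funext j L
  show classWt (w ∘ patMap σ hσ) j L = classWt w (σ j) (relMap σ L)
  unfold classWt
  by_cases h : IsPattern j L
  · rw [dif_pos h, dif_pos (h.map hσ)]
    rfl
  · rw [dif_neg h, dif_neg (fun h' => h ((isPattern_map_iff hσ).1 h'))]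

/-- membership in the solution space is the tripod law of the class weight. [cite: KhristoforovSmirnov2021, §2 Lemma 4 (arXiv v1 p. 4)] -/
theorem mem_solW_iff_tripodLaw_classWt {w : Pat nm → ℂ} : w ∈ solW nm ↔ TripodLaw (classWt w) := by
  rw [tripodLaw_iff_restrict_mem_solW, restrictW_classWt]

/-- ★★ **THE SOLUTION SPACE OF THE TRIPOD LAW IS STABLE UNDER CYCLIC SYMMETRIES**: `w ∈ solW k` iff `w ∘ σ ∈ solW k`.
[cite: KhristoforovSmirnov2021, §2 Lemma 4, proof and Fig. 3 (arXiv v1 p. 4); §1.2 (p. 2: cyclic indexing)] -/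
theorem comp_patMap_mem_solW_iff {σ : Equiv.Perm (Fin nm)} (hσ : IsCyc σ) {w : Pat nm → ℂ} :
    w ∘ patMap σ hσ ∈ solW nm ↔ w ∈ solW nm := by
  rw [mem_solW_iff_tripodLaw_classWt, mem_solW_iff_tripodLaw_classWt, classWt_comp_patMap, tripodLaw_rotW_iff hσ]

/-- the stable direction as a lemma. [cite: KhristoforovSmirnov2021, §2 Lemma 4 (arXiv v1 p. 4)] -/
theorem comp_patMap_mem_solW {σ : Equiv.Perm (Fin nm)} (hσ : IsCyc σ) {w : Pat nm → ℂ} (hw : w ∈ solW nm) :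
    w ∘ patMap σ hσ ∈ solW nm :=
  (comp_patMap_mem_solW_iff hσ).2 hw

variable (nm) in
/-- ★ **the cyclic symmetry as a linear automorphism of the solution space.** [cite: KhristoforovSmirnov2021, §2 Lemma 4 (arXiv v1 p. 4)] -/
noncomputable def solWRot (σ : Equiv.Perm (Fin nm)) (hσ : IsCyc σ) : solW nm ≃ₗ[ℂ] solW nm where
  toFun w := ⟨w.1 ∘ patMap σ hσ, comp_patMap_mem_solW hσ w.2⟩
  map_add' _ _ := rfl
  map_smul' _ _ := rfl
  invFun w := ⟨w.1 ∘ patMap σ.symm hσ.symm, comp_patMap_mem_solW hσ.symm w.2⟩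
  left_inv w := by
    apply Subtype.ext
    funext p
    show w.1 (patMap σ hσ (patMap σ.symm hσ.symm p)) = w.1 p
    rw [← patMap_symm σ hσ, Equiv.apply_symm_apply]
  right_inv w := by
    apply Subtype.ext
    funext p
    show w.1 (patMap σ.symm hσ.symm (patMap σ hσ p)) = w.1 p
    rw [← patMap_symm σ hσ, Equiv.symm_apply_apply]

/-- the automorphism evaluated. [cite: KhristoforovSmirnov2021, §2 Lemma 4 (arXiv v1 p. 4)] -/
theorem solWRot_apply (σ : Equiv.Perm (Fin nm)) (hσ : IsCyc σ) (w : solW nm) (p : Pat nm) :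
    (solWRot nm σ hσ w : Pat nm → ℂ) p = w.1 (patMap σ hσ p) := rfl

end Transport


/-! ### Cuts: the patterns compatible with a boundary arc -/

section Cuts

variable {nm : ℕ}

/-- `x` lies strictly inside the anticlockwise arc of corners from `c` to `d`. [cite: KhristoforovSmirnov2021, §1.2 (arXiv v1 p. 2: counterclockwise cyclic indexing)] -/
def InArc (c d x : Fin nm) : Prop := CcwTriple c x d

/-- the boundary arc `A_a` (from `u_a` to `u_{a+1}`) lies inside the anticlockwise arc of corners from `c` to `d`.
[cite: KhristoforovSmirnov2021, §1.2 (arXiv v1 p. 2); §2 eq. (4) (p. 5: `z ∈ u_{j−1}u_{j+1}`)] -/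
def GapInArc (c d a : Fin nm) : Prop := a = c ∨ CcwTriple c a d

/-- ★ **a pattern COMPATIBLE WITH THE CUT at `a`**: every chord has the partner and the arc `A_a` on the same side — the link pattern of the
`k + 1` points `u_0, …, u_a, z, u_{a+1}, …, u_{k−1}` (`z ∈ A_a` linked to the partner) is NON-CROSSING. For the home arc `a = k − 1` these are
the OUTERMOST patterns (`cutCompat_iff_pdepth_eq_zero`). [cite: KhristoforovSmirnov2021, §1.2 (arXiv v1 p. 2: «IP(ξ) is a union of disjoint paths, matching marked points»); §2 eq. (4) (p. 5)] -/
def CutCompat (a : Fin nm) (p : Pat nm) : Prop := ∀ cd ∈ p.1.2, InArc cd.1 cd.2 p.1.1 ↔ GapInArc cd.1 cd.2 a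

/-- inside an increasing chord. [cite: KhristoforovSmirnov2021, §1.2 (arXiv v1 p. 2: counterclockwise cyclic indexing)] -/
theorem inArc_iff_of_lt {c d x : Fin nm} (h : c < d) : InArc c d x ↔ c < x ∧ x < d := by
  unfold InArc CcwTriple
  simp only [Fin.lt_def] at *
  omega

/-- the arc `A_a` inside an increasing chord. [cite: KhristoforovSmirnov2021, §1.2 (arXiv v1 p. 2: counterclockwise cyclic indexing)] -/
theorem gapInArc_iff_of_lt {c d a : Fin nm} (h : c < d) : GapInArc c d a ↔ c ≤ a ∧ a < d := by
  unfold GapInArc CcwTriple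
  rw [Fin.ext_iff]
  simp only [Fin.lt_def, Fin.le_def] at *
  omega

/-- cyclic symmetries transport `InArc`. [cite: KhristoforovSmirnov2021, §1.2 (arXiv v1 p. 2)] -/
theorem IsCyc.inArc {σ : Equiv.Perm (Fin nm)} (hσ : IsCyc σ) (c d x : Fin nm) : InArc (σ c) (σ d) (σ x) ↔ InArc c d x :=
  hσ c x d

/-- cyclic symmetries transport `GapInArc`. [cite: KhristoforovSmirnov2021, §1.2 (arXiv v1 p. 2)] -/
theorem IsCyc.gapInArc {σ : Equiv.Perm (Fin nm)} (hσ : IsCyc σ) (c d a : Fin nm) : GapInArc (σ c) (σ d) (σ a) ↔ GapInArc c d a := by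
  unfold GapInArc
  rw [σ.apply_eq_iff_eq, hσ]

/-- ★ **compatibility is transported by cyclic symmetries**: `σ p` is compatible with the cut at `σ a` iff `p` is compatible with the cut at `a`.
[cite: KhristoforovSmirnov2021, §1.2 (arXiv v1 p. 2: cyclic indexing)] -/
theorem cutCompat_patMap_iff {σ : Equiv.Perm (Fin nm)} (hσ : IsCyc σ) {a : Fin nm} {p : Pat nm} :
    CutCompat (σ a) (patMap σ hσ p) ↔ CutCompat a p := by
  unfold CutCompat
  rw [patMap_val]
  constructor
  · intro h cd hcd
    have key := h (σ cd.1, σ cd.2) (mem_relMap_apply.2 hcd)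
    rwa [hσ.inArc, hσ.gapInArc] at key
  · intro h cd hcd
    rw [mem_relMap'] at hcd
    have key := h _ hcd
    rw [← hσ.inArc, ← hσ.gapInArc (σ := σ), σ.apply_symm_apply, σ.apply_symm_apply] at key
    exact key

/-- **compatibility in increasing-chord form** (the one-car's arc-law shape): for every chord `(c, d)` with `c < d`,
`c < j < d ↔ c ≤ a < d`. [cite: KhristoforovSmirnov2021, §1.2 (arXiv v1 p. 2); §2 eq. (4) (p. 5)] -/
theorem cutCompat_iff_lt {a : Fin nm} {p : Pat nm} :
    CutCompat a p ↔ ∀ cd ∈ p.1.2, cd.1 < cd.2 → ((cd.1 < p.1.1 ∧ p.1.1 < cd.2) ↔ (cd.1 ≤ a ∧ a < cd.2)) := by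
  constructor
  · intro h cd hcd hlt
    rw [← inArc_iff_of_lt hlt, ← gapInArc_iff_of_lt hlt]
    exact h cd hcd
  · intro h cd hcd
    rcases lt_trichotomy cd.1 cd.2 with hlt | heq | hgt
    · rw [inArc_iff_of_lt hlt, gapInArc_iff_of_lt hlt]
      exact h cd hcd hlt
    · exact absurd heq (p.2.ne_of_mem (a := cd.1) (b := cd.2) hcd)
    · have hsym : (cd.2, cd.1) ∈ p.1.2 := p.2.symm _ _ hcd
      have key := h (cd.2, cd.1) hsym hgt
      have hj1 : p.1.1 ≠ cd.1 := fun e => p.2.off _ _ hcd e.symm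
      have hj2 : p.1.1 ≠ cd.2 := fun e => (p.2.off₂ (a := cd.1) (b := cd.2) hcd) e.symm
      have hj1' := Fin.val_ne_of_ne hj1
      have hj2' := Fin.val_ne_of_ne hj2
      unfold InArc GapInArc CcwTriple
      rw [Fin.ext_iff]
      simp only [Fin.lt_def, Fin.le_def] at *
      omega

/-- ★ **for the HOME ARC `a = k − 1` compatibility is outermost-ness** (depth `0`). [cite: KhristoforovSmirnov2021, §1.2 (arXiv v1 p. 2); §2 eq. (4) (p. 5)] -/
theorem cutCompat_iff_pdepth_eq_zero {a : Fin nm} (ha : a.val + 1 = nm) {p : Pat nm} : CutCompat a p ↔ p.pdepth = 0 := by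
  rw [cutCompat_iff_lt]
  unfold Pat.pdepth
  rw [depth_eq_zero_iff]
  constructor
  · rintro h cd hcd ⟨h1, h2⟩
    have key := (h cd hcd (lt_trans h1 h2)).1 ⟨h1, h2⟩
    have := cd.2.2
    rw [Fin.lt_def] at key
    omega
  · intro h cd hcd hlt
    refine ⟨fun h12 => absurd h12 (h cd hcd), fun h12 => ?_⟩
    have := cd.2.2
    rw [Fin.lt_def] at h12
    omega

open Classical in
/-- **the patterns compatible with the cut at `a`**, as a finset. [cite: KhristoforovSmirnov2021, §1.2 (arXiv v1 p. 2)] -/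
noncomputable def outAt (a : Fin nm) : Finset (Pat nm) := Finset.univ.filter (CutCompat a)

open Classical in
/-- membership in `outAt a`. [cite: KhristoforovSmirnov2021, §1.2 (arXiv v1 p. 2)] -/
theorem mem_outAt {a : Fin nm} {p : Pat nm} : p ∈ outAt a ↔ CutCompat a p := by
  unfold outAt
  rw [Finset.mem_filter]
  exact ⟨fun h => h.2, fun h => ⟨Finset.mem_univ _, h⟩⟩

/-- **the shift to the cut at `a`**: the `(a+1)`-fold rotation, taking the last corner to `a`. [cite: KhristoforovSmirnov2021, §1.2 (arXiv v1 p. 2: cyclic indexing)] -/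
def cutShift (a : Fin nm) : Equiv.Perm (Fin nm) := rot nm ^ (a.val + 1)

/-- the shift is a cyclic symmetry. [cite: KhristoforovSmirnov2021, §1.2 (arXiv v1 p. 2)] -/
theorem isCyc_cutShift (a : Fin nm) : IsCyc (cutShift a) := isCyc_rot_pow _

/-- the shift takes the last corner to `a`. [cite: KhristoforovSmirnov2021, §1.2 (arXiv v1 p. 2: counterclockwise cyclic indexing)] -/
theorem cutShift_apply_last (a a' : Fin nm) (ha' : a'.val + 1 = nm) : cutShift a a' = a := by
  apply Fin.ext
  unfold cutShift
  rw [val_rot_pow, show a'.val + (a.val + 1) = a.val + nm by omega, Nat.add_mod_right, Nat.mod_eq_of_lt a.2]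

/-- the last corner (there is one as soon as there is any). [cite: KhristoforovSmirnov2021, §1.2 (arXiv v1 p. 2: counterclockwise cyclic indexing)] -/
def lastOf (a : Fin nm) : Fin nm := ⟨nm - 1, by have := a.2; omega⟩

/-- its value. [cite: KhristoforovSmirnov2021, §1.2 (arXiv v1 p. 2: counterclockwise cyclic indexing)] -/
theorem lastOf_val (a : Fin nm) : (lastOf a).val + 1 = nm := by have := a.2; unfold lastOf; simp only; omega

/-- **the home pattern of `q` seen from the cut at `a`**: shift back by `a + 1`. [cite: KhristoforovSmirnov2021, §1.2 (arXiv v1 p. 2)] -/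
noncomputable def unshift (a : Fin nm) (q : Pat nm) : Pat nm := (patMap (cutShift a) (isCyc_cutShift a)).symm q

/-- shifting the home pattern forward gives `q` back. [cite: KhristoforovSmirnov2021, §1.2 (arXiv v1 p. 2: counterclockwise cyclic indexing)] -/
theorem patMap_unshift (a : Fin nm) (q : Pat nm) : patMap (cutShift a) (isCyc_cutShift a) (unshift a q) = q :=
  Equiv.apply_symm_apply _ _

/-- ★ **a pattern is compatible with the cut at `a` iff its home pattern is outermost.** [cite: KhristoforovSmirnov2021, §1.2 (arXiv v1 p. 2); §2 eq. (4) (p. 5)] -/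
theorem cutCompat_iff_pdepth_unshift {a : Fin nm} {q : Pat nm} : CutCompat a q ↔ (unshift a q).pdepth = 0 := by
  rw [← cutCompat_iff_pdepth_eq_zero (lastOf_val a), ← cutCompat_patMap_iff (isCyc_cutShift a) (a := lastOf a) (p := unshift a q),
    cutShift_apply_last a _ (lastOf_val a), patMap_unshift]

/-- conversely, shifting an outermost pattern gives a compatible one. [cite: KhristoforovSmirnov2021, §1.2 (arXiv v1 p. 2)] -/
theorem cutCompat_patMap_cutShift {a : Fin nm} {p : Pat nm} : CutCompat a (patMap (cutShift a) (isCyc_cutShift a) p) ↔ p.pdepth = 0 := by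
  rw [cutCompat_iff_pdepth_unshift]
  unfold unshift
  rw [Equiv.symm_apply_apply]

/-- ★ **`outAt a ≃ Pat₀ k`**: the compatible patterns for any cut are in bijection with the outermost patterns (hence with the non-crossing
perfect matchings of `k + 1` points, `pat₀EquivNCMatching`). [cite: KhristoforovSmirnov2021, §1.2 (arXiv v1 p. 2: the link pattern)] -/
noncomputable def outAtEquiv (a : Fin nm) : {p : Pat nm // p ∈ outAt a} ≃ Pat₀ nm where
  toFun p := ⟨unshift a p.1, cutCompat_iff_pdepth_unshift.1 (mem_outAt.1 p.2)⟩
  invFun q := ⟨patMap (cutShift a) (isCyc_cutShift a) q.1, mem_outAt.2 (cutCompat_patMap_cutShift.2 q.2)⟩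
  left_inv p := Subtype.ext (patMap_unshift a p.1)
  right_inv q := Subtype.ext (by
    show unshift a (patMap (cutShift a) (isCyc_cutShift a) q.1) = q.1
    unfold unshift
    rw [Equiv.symm_apply_apply])

/-- ★ **the number of compatible patterns is the same for every cut**: `#outAt a = #Pat₀ k`. [cite: KhristoforovSmirnov2021, §1.2 (arXiv v1 p. 2)] -/
theorem card_outAt (a : Fin nm) : (outAt a).card = Fintype.card (Pat₀ nm) := by
  rw [← Fintype.card_coe (outAt a)]
  exact Fintype.card_congr (outAtEquiv a)

/-- … `= #NCMatching (k + 1)`, the number of link patterns of `k + 1` points. [cite: KhristoforovSmirnov2021, §1.2 (arXiv v1 p. 2: the link pattern)] -/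
theorem card_outAt_eq_card_ncMatching (a : Fin nm) : (outAt a).card = Fintype.card (NCMatching (nm + 1)) := by
  rw [card_outAt, card_pat₀_eq_card_ncMatching]

/-- ★ **UNIQUENESS FROM ANY CUT**: two solutions of the tripod law agreeing on the patterns compatible with one cut coincide.
[cite: KhristoforovSmirnov2021, §2 Lemma 4, proof and Fig. 3 (arXiv v1 p. 4)] -/
theorem eq_of_mem_solW_of_cutCompat (a : Fin nm) {w w' : Pat nm → ℂ} (hw : w ∈ solW nm) (hw' : w' ∈ solW nm)
    (h : ∀ p : Pat nm, CutCompat a p → w p = w' p) : w = w' := by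
  set S := patMap (cutShift a) (isCyc_cutShift a) with hS
  have key : w ∘ S = w' ∘ S :=
    eq_of_mem_solW (comp_patMap_mem_solW _ hw) (comp_patMap_mem_solW _ hw') fun p hp =>
      h (S p) (cutCompat_patMap_cutShift.2 hp)
  funext p
  have e := congrFun key (S.symm p)
  simp only [Function.comp_apply, Equiv.apply_symm_apply] at e
  exact e

end Cuts

/-! ### The basis adapted to a cut -/

section CutBasis

variable {nm : ℕ}

open Classical in
/-- ★★ **THE BASIS SOLUTION OF A COMPATIBLE PATTERN `q` FOR THE CUT AT `a`**: the solution of the tripod law equal to `δ_q` on the patterns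
compatible with the cut at `a` — the home basis solution of the home pattern of `q`, shifted forward (zero if `q` is not compatible).
[cite: KhristoforovSmirnov2021, §2 Lemma 4, proof and Fig. 3 (arXiv v1 p. 4); eq. (4) and Remark 6 (p. 5)] -/
noncomputable def basisWAt (a : Fin nm) (q : Pat nm) : Pat nm → ℂ :=
  if h : CutCompat a q then basisW ⟨unshift a q, cutCompat_iff_pdepth_unshift.1 h⟩ ∘ (patMap (cutShift a) (isCyc_cutShift a)).symm
  else 0

open Classical in
/-- off the compatible patterns the definition is `0`. [cite: KhristoforovSmirnov2021, §1.2 (arXiv v1 p. 2: counterclockwise cyclic indexing)] -/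
theorem basisWAt_of_not {a : Fin nm} {q : Pat nm} (h : ¬ CutCompat a q) : basisWAt a q = 0 := by
  unfold basisWAt; rw [dif_neg h]

open Classical in
/-- the definition unfolded on a compatible pattern. [cite: KhristoforovSmirnov2021, §2 Lemma 4 (arXiv v1 p. 4)] -/
theorem basisWAt_apply {a : Fin nm} {q : Pat nm} (h : CutCompat a q) (p : Pat nm) :
    basisWAt a q p = basisW ⟨unshift a q, cutCompat_iff_pdepth_unshift.1 h⟩ (unshift a p) := by
  unfold basisWAt; rw [dif_pos h]; rfl

/-- ★ **the adapted basis solutions solve the tripod law.** [cite: KhristoforovSmirnov2021, §2 Lemma 4, proof and Fig. 3 (arXiv v1 p. 4)] -/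
theorem basisWAt_mem_solW (a : Fin nm) (q : Pat nm) : basisWAt a q ∈ solW nm := by
  by_cases h : CutCompat a q
  · have e : basisWAt a q = basisW ⟨unshift a q, cutCompat_iff_pdepth_unshift.1 h⟩ ∘ patMap (cutShift a).symm (isCyc_cutShift a).symm := by
      funext p; rw [basisWAt_apply h]; rfl
    rw [e]
    exact comp_patMap_mem_solW _ (basisW_mem_solW _)
  · rw [basisWAt_of_not h]; exact Submodule.zero_mem _

/-- hence their class weights give discretely holomorphic `k`-disorder observables on every `k`-marked domain.
[cite: KhristoforovSmirnov2021, §2 Lemma 4 eq. (3) (arXiv v1 p. 4)] -/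
theorem holomorphicW_basisWAt (D : TriMarkedDomain nm) (a : Fin nm) (q : Pat nm) : HolomorphicW D (classWt (basisWAt a q)) :=
  holomorphicW_classWt D (basisWAt_mem_solW a q)

/-- ★★ **ON THE COMPATIBLE PATTERNS THE ADAPTED BASIS IS `δ`**: `basisWAt a q p = [p = q]` for `p, q` compatible with the cut at `a`.
[cite: KhristoforovSmirnov2021, §2 Lemma 4 (arXiv v1 p. 4); eq. (4) (p. 5)] -/
theorem basisWAt_apply_of_cutCompat {a : Fin nm} {q p : Pat nm} (hq : CutCompat a q) (hp : CutCompat a p) :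
    basisWAt a q p = if p = q then 1 else 0 := by
  rw [basisWAt_apply hq, basisW_of_zero _ _ (cutCompat_iff_pdepth_unshift.1 hp)]
  have e : ((unshift a p).1 = (unshift a q).1) ↔ p = q := by
    rw [← Subtype.ext_iff]
    exact (patMap (cutShift a) (isCyc_cutShift a)).symm.injective.eq_iff
  simp only [e]

/-- ★★★ **EXPANSION IN THE ADAPTED BASIS**: every solution of the tripod law is `Σ_{q ∈ outAt a} w q · basisWAt a q` — its values on the
patterns compatible with ANY ONE cut are free and determine it. [cite: KhristoforovSmirnov2021, §2 Lemma 4, proof and Fig. 3 (arXiv v1 p. 4)] -/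
theorem eq_sum_basisWAt_of_mem_solW (a : Fin nm) {w : Pat nm → ℂ} (hw : w ∈ solW nm) :
    w = ∑ q ∈ outAt a, w q • basisWAt a q := by
  refine eq_of_mem_solW_of_cutCompat a hw (Submodule.sum_mem _ fun q _ => Submodule.smul_mem _ _ (basisWAt_mem_solW a q)) ?_
  intro p hp
  rw [Finset.sum_apply, Finset.sum_eq_single_of_mem p (mem_outAt.2 hp)]
  · rw [Pi.smul_apply, smul_eq_mul, basisWAt_apply_of_cutCompat hp hp, if_pos rfl, mul_one]
  · intro q hq hqp
    rw [Pi.smul_apply, smul_eq_mul, basisWAt_apply_of_cutCompat (mem_outAt.1 hq) hp, if_neg (Ne.symm hqp), mul_zero]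

/-- **dimension count from any cut**: `finrank solW k = #outAt a`. [cite: KhristoforovSmirnov2021, §2 Lemma 4 (arXiv v1 p. 4); §1.2 (p. 2)] -/
theorem finrank_solW_eq_card_outAt (a : Fin nm) : Module.finrank ℂ (solW nm) = (outAt a).card := by
  rw [finrank_solW, card_outAt]

/-- ★ **for the home arc the adapted basis IS the home basis**: `basisWAt (k−1) q = basisW q`.
[cite: KhristoforovSmirnov2021, §2 Lemma 4 (arXiv v1 p. 4); eq. (4) (p. 5)] -/
theorem basisWAt_last {a : Fin nm} (ha : a.val + 1 = nm) (q : Pat₀ nm) : basisWAt a q.1 = basisW q := by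
  have hq : CutCompat a q.1 := (cutCompat_iff_pdepth_eq_zero ha).2 q.2
  refine eq_of_mem_solW (basisWAt_mem_solW a q.1) (basisW_mem_solW q) fun p hp => ?_
  rw [basisWAt_apply_of_cutCompat hq ((cutCompat_iff_pdepth_eq_zero ha).2 hp), basisW_of_zero q p hp]
  have e : p = q.1 ↔ p.1 = q.1.1 := Subtype.ext_iff
  simp only [e]

/-- ★★ **CHANGE OF CUT, I**: the home basis in the adapted basis — `basisW q = Σ_{p ∈ outAt a} basisW q p · basisWAt a p`: the matrix
`(basisW q p)_{q ∈ Pat₀, p ∈ outAt a}` (entries `0` or signed powers of `τ`, `basisW_eq_zero_or_coefN`) is the change of basis.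
[cite: KhristoforovSmirnov2021, §2 Lemma 4, proof and Fig. 3 (arXiv v1 p. 4); eq. (4) and Remark 6 (p. 5)] -/
theorem basisW_eq_sum_basisWAt (a : Fin nm) (q : Pat₀ nm) : basisW q = ∑ p ∈ outAt a, basisW q p • basisWAt a p :=
  eq_sum_basisWAt_of_mem_solW a (basisW_mem_solW q)

/-- ★★ **CHANGE OF CUT, II**: the adapted basis in the home basis — `basisWAt a p = Σ_{q : Pat₀} basisWAt a p q · basisW q`.
[cite: KhristoforovSmirnov2021, §2 Lemma 4, proof and Fig. 3 (arXiv v1 p. 4)] -/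
theorem basisWAt_eq_sum_basisW (a : Fin nm) (p : Pat nm) : basisWAt a p = ∑ q : Pat₀ nm, basisWAt a p q.1 • basisW q :=
  eq_sum_basisW_of_mem_solW (basisWAt_mem_solW a p)

/-- ★ **the two change-of-cut matrices are mutually inverse, I**: `Σ_{p ∈ outAt a} basisW q p · basisWAt a p q' = [q' = q]`.
[cite: KhristoforovSmirnov2021, §2 Lemma 4 (arXiv v1 p. 4)] -/
theorem sum_basisW_mul_basisWAt (a : Fin nm) (q q' : Pat₀ nm) :
    ∑ p ∈ outAt a, basisW q p * basisWAt a p q'.1 = if q' = q then 1 else 0 := by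
  have e := congrFun (basisW_eq_sum_basisWAt a q) q'.1
  rw [Finset.sum_apply] at e
  simp only [Pi.smul_apply, smul_eq_mul] at e
  rw [← e, basisW_of_zero q q'.1 q'.2]
  have e' : q'.1.1 = q.1.1 ↔ q' = q := by rw [← Subtype.ext_iff, ← Subtype.ext_iff]
  simp only [e']

/-- ★ **… and II**: `Σ_{q : Pat₀} basisWAt a p q · basisW q p' = [p' = p]` for `p, p'` compatible with the cut at `a`.
[cite: KhristoforovSmirnov2021, §2 Lemma 4 (arXiv v1 p. 4)] -/
theorem sum_basisWAt_mul_basisW (a : Fin nm) {p p' : Pat nm} (hp : CutCompat a p) (hp' : CutCompat a p') :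
    ∑ q : Pat₀ nm, basisWAt a p q.1 * basisW q p' = if p' = p then 1 else 0 := by
  have e := congrFun (basisWAt_eq_sum_basisW a p) p'
  rw [Finset.sum_apply] at e
  simp only [Pi.smul_apply, smul_eq_mul] at e
  rw [← e, basisWAt_apply_of_cutCompat hp hp']

end CutBasis

/-! ### Equivariance of the cuts and of the adapted bases under cyclic symmetries -/

section Equivariance

variable {nm : ℕ}

/-- ★ **the compatible patterns are transported**: `σ (outAt a) = outAt (σ a)` for every cyclic `σ`.
[cite: KhristoforovSmirnov2021, §1.2 (arXiv v1 p. 2: counterclockwise cyclic indexing)] -/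
theorem outAt_map {σ : Equiv.Perm (Fin nm)} (hσ : IsCyc σ) (a : Fin nm) :
    (outAt a).map (patMap σ hσ).toEmbedding = outAt (σ a) := by
  ext p
  rw [Finset.mem_map_equiv, mem_outAt, mem_outAt, ← cutCompat_patMap_iff hσ (a := a) (p := (patMap σ hσ).symm p),
    Equiv.apply_symm_apply]

/-- ★★ **THE ADAPTED BASES ARE EQUIVARIANT UNDER EVERY CYCLIC SYMMETRY**: `basisWAt (σ a) (σ q) (σ p) = basisWAt a q p` — the adapted basis
of a cut is an intrinsic object of the cyclically ordered marks (by uniqueness from the cut at `a`).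
[cite: KhristoforovSmirnov2021, §2 Lemma 4, proof and Fig. 3 (arXiv v1 p. 4); §1.2 (p. 2: cyclic indexing)] -/
theorem basisWAt_equivariant {σ : Equiv.Perm (Fin nm)} (hσ : IsCyc σ) (a : Fin nm) (q p : Pat nm) :
    basisWAt (σ a) (patMap σ hσ q) (patMap σ hσ p) = basisWAt a q p := by
  by_cases hq : CutCompat a q
  · have hq' : CutCompat (σ a) (patMap σ hσ q) := (cutCompat_patMap_iff hσ).2 hq
    have key : basisWAt (σ a) (patMap σ hσ q) ∘ patMap σ hσ = basisWAt a q := by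
      refine eq_of_mem_solW_of_cutCompat a (comp_patMap_mem_solW hσ (basisWAt_mem_solW _ _)) (basisWAt_mem_solW a q) ?_
      intro p' hp'
      rw [Function.comp_apply, basisWAt_apply_of_cutCompat hq' ((cutCompat_patMap_iff hσ).2 hp'), basisWAt_apply_of_cutCompat hq hp']
      simp only [(patMap σ hσ).injective.eq_iff]
    exact congrFun key p
  · have hq' : ¬ CutCompat (σ a) (patMap σ hσ q) := fun h => hq ((cutCompat_patMap_iff hσ).1 h)
    rw [basisWAt_of_not hq, basisWAt_of_not hq']
    rfl

/-- the same with the symmetry moved to the other side: `basisWAt a q ∘ σ⁻¹ = basisWAt (σ a) (σ q)`.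
[cite: KhristoforovSmirnov2021, §2 Lemma 4 (arXiv v1 p. 4); §1.2 (p. 2)] -/
theorem basisWAt_comp_patMap_symm {σ : Equiv.Perm (Fin nm)} (hσ : IsCyc σ) (a : Fin nm) (q : Pat nm) :
    basisWAt a q ∘ patMap σ.symm hσ.symm = basisWAt (σ a) (patMap σ hσ q) := by
  funext p
  rw [Function.comp_apply, ← basisWAt_equivariant hσ a q (patMap σ.symm hσ.symm p), ← patMap_symm σ hσ, Equiv.apply_symm_apply]

/-- ★ in particular **every adapted basis is a shifted home basis and conversely**: `basisWAt a q ∘ shift = basisW (unshift q)` for `q`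
compatible with the cut at `a`. [cite: KhristoforovSmirnov2021, §2 Lemma 4 (arXiv v1 p. 4); eq. (4) (p. 5)] -/
theorem basisWAt_comp_cutShift {a : Fin nm} {q : Pat nm} (hq : CutCompat a q) :
    basisWAt a q ∘ patMap (cutShift a) (isCyc_cutShift a) = basisW ⟨unshift a q, cutCompat_iff_pdepth_unshift.1 hq⟩ := by
  funext p
  rw [Function.comp_apply, basisWAt_apply hq]
  unfold unshift
  rw [Equiv.symm_apply_apply]

end Equivariance

end Literature.Probability.Percolation.MarkedLoops

/-! ## The lattice side: boundary values on every arc -/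

namespace Literature.Probability.Percolation.MarkedLoops

open Literature.Probability.Percolation Literature.Probability.LatticeModels
open Literature.Probability.Percolation.FivePoint (side xiDeg XiLinked tau)
open TriMarkedDomain

/-! ### Boundary values on EVERY arc -/

section AllArcs

variable {nm : ℕ} {D : TriMarkedDomain nm}

/-- ★ **on the arc `A_a` the pattern of every configuration is compatible with the cut at `a`** (the arc law, packaged).
[cite: KhristoforovSmirnov2021, §1.2 (arXiv v1 p. 2: «IP(ξ) is a union of disjoint paths, matching marked points»); §2 eq. (4) (p. 5)] -/
theorem cutCompat_of_boundary {v : HexVertex} (hv : AllSides D v) {i : Fin 3} {s : HexVertex}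
    (hs : s ∈ ({v, oppFace v i} : Finset HexVertex)) (hsc : s ∉ corners D) {g o : Site 2} (he : side v i = s(g, o))
    {a : Fin nm} (hd : (g, o) ∈ D.stretch a) {ξ : Finset (Sym2 (Site 2))} (hξ : ξ ∈ TXb D v i s)
    {m : Fin nm} (hm : XiLinked ξ s (yc D m)) (hpat : IsPattern m (linkRel D ξ)) : CutCompat a ⟨(m, linkRel D ξ), hpat⟩ := by
  rw [cutCompat_iff_lt]
  intro cd hcd hlt
  exact encl_iff_encl_gap_of_boundary hv hs hsc he hd hξ hm hcd hlt (fun e => hpat.off _ _ hcd e.symm)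
    (fun e => (hpat.off₂ (a := cd.1) (b := cd.2) hcd) e.symm)

/-- the same from the class predicate. [cite: KhristoforovSmirnov2021, §1.2 (arXiv v1 p. 2); §2 eq. (4) (p. 5)] -/
theorem cutCompat_of_boundary_inClassX {v : HexVertex} (hv : AllSides D v) {i : Fin 3} {s : HexVertex}
    (hs : s ∈ ({v, oppFace v i} : Finset HexVertex)) (hsc : s ∉ corners D) {g o : Site 2} (he : side v i = s(g, o))
    {a : Fin nm} (hd : (g, o) ∈ D.stretch a) {ξ : Finset (Sym2 (Site 2))} (hξ : ξ ∈ TXb D v i s)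
    {m : Fin nm} (hcl : InClassX D (faceVertex v (i + 1)) (faceVertex v (i + 2)) s m ξ) :
    CutCompat a ⟨(m, linkRel D ξ), isPattern_linkRel hv hs hsc hξ hcl⟩ := by
  obtain ⟨-, Y, hY, hlink⟩ := hcl
  rw [eq_yc D hY] at hlink
  exact cutCompat_of_boundary hv hs hsc he hd hξ hlink _

/-- ★★ **THE PATTERN-COUNT EXPANSION ON THE ARC `A_a` RUNS OVER THE COMPATIBLE PATTERNS ONLY**:
`ObsW D (classWt w) v i = Σ_{p ∈ outAt a} w p · N_p(z)` at a boundary mid-edge `z ∈ A_a`.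
[cite: KhristoforovSmirnov2021, §2 Definition 3 (arXiv v1 p. 4: `F(z) = E[H(ξ)]`); eq. (4) and Remark 6 (p. 5)] -/
theorem obsW_classWt_eq_sum_outAt (w : Pat nm → ℂ) {v : HexVertex} (hv : AllSides D v) {i : Fin 3} (hvc : v ∉ corners D)
    (hoc : oppFace v i ∉ corners D) {g o : Site 2} (he : side v i = s(g, o)) {a : Fin nm} (hd : (g, o) ∈ D.stretch a) :
    ObsW D (classWt w) v i = ∑ p ∈ outAt a, w p * (patternCount D v i p : ℂ) := by
  rw [obsW_classWt_eq_sum_patternCount w hv hvc hoc]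
  symm
  refine Finset.sum_subset (Finset.subset_univ _) fun p _ hp => ?_
  have hp' : ∃ cd ∈ p.1.2, cd.1 < cd.2 ∧ ¬ ((cd.1 < p.1.1 ∧ p.1.1 < cd.2) ↔ (cd.1 ≤ a ∧ a < cd.2)) := by
    by_contra hcon
    apply hp
    rw [mem_outAt, cutCompat_iff_lt]
    intro cd hcd hlt
    by_contra hne
    exact hcon ⟨cd, hcd, hlt, hne⟩
  obtain ⟨cd, hcd, hlt, hsep⟩ := hp'
  rw [patternCount_eq_zero_of_boundary hv hvc hoc he hd p hcd hlt hsep, Nat.cast_zero, mul_zero]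

/-- the same for an arbitrary tripod-law class weight (the observable sees only its pattern values).
[cite: KhristoforovSmirnov2021, §2 Definition 3 and Lemma 4 (arXiv v1 p. 4); eq. (4) (p. 5)] -/
theorem obsW_eq_sum_outAt (wt : Fin nm → Finset (Fin nm × Fin nm) → ℂ) {v : HexVertex} (hv : AllSides D v) {i : Fin 3}
    (hvc : v ∉ corners D) (hoc : oppFace v i ∉ corners D) {g o : Site 2} (he : side v i = s(g, o)) {a : Fin nm}
    (hd : (g, o) ∈ D.stretch a) : ObsW D wt v i = ∑ p ∈ outAt a, wt p.1.1 p.1.2 * (patternCount D v i p : ℂ) := by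
  rw [← obsW_classWt_restrictW wt hv hvc hoc, obsW_classWt_eq_sum_outAt _ hv hvc hoc he hd]
  rfl

/-- ★★★ **THE BOUNDARY LAW OF THE ADAPTED BASIS ON ITS OWN ARC**: at `z ∈ A_a` the observable of the adapted basis solution `basisWAt a q`
(`q` compatible with the cut at `a`) is the COUNT `N_q(z)` of configurations realising the pattern `q` — for every arc there is a basis of the
solution space whose observables are link-pattern counts on that arc (for the home arc: `obsW_basis_boundary_last`).
[cite: KhristoforovSmirnov2021, §2 eq. (4) and Remark 6 (arXiv v1 p. 5); Definition 3 (p. 4)] -/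
theorem obsW_basisWAt_boundary {a : Fin nm} {q : Pat nm} (hq : CutCompat a q) {v : HexVertex} (hv : AllSides D v) {i : Fin 3}
    (hvc : v ∉ corners D) (hoc : oppFace v i ∉ corners D) {g o : Site 2} (he : side v i = s(g, o)) (hd : (g, o) ∈ D.stretch a) :
    ObsW D (classWt (basisWAt a q)) v i = (patternCount D v i q : ℂ) := by
  rw [obsW_classWt_eq_sum_outAt _ hv hvc hoc he hd, Finset.sum_eq_single_of_mem q (mem_outAt.2 hq)]
  · rw [basisWAt_apply_of_cutCompat hq hq, if_pos rfl, one_mul]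
  · intro p hp hpq
    rw [basisWAt_apply_of_cutCompat hq (mem_outAt.1 hp), if_neg hpq, zero_mul]

/-- ★★ **THE BOUNDARY VALUES OF THE HOME BASIS ON EVERY ARC**: at `z ∈ A_a`,
`ObsW D (classWt (basisW q)) v i = Σ_{p ∈ outAt a} basisW q p · N_p(z)` — a fixed complex combination (coefficients `0` or signed powers of
`τ`, `basisW_eq_zero_or_coefN`) of the `#NCMatching (k+1)` compatible pattern counts; together with `holomorphicW_basisW` this is the full
discrete Riemann–Hilbert datum of each basis observable: holomorphic inside, prescribed count-combinations on all `k` arcs.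
[cite: KhristoforovSmirnov2021, §2 eq. (4) and Remark 6 (arXiv v1 p. 5); §3 (pp. 5–7: the boundary-value problem, `k = 3`)] -/
theorem obsW_basisW_boundary (q : Pat₀ nm) {v : HexVertex} (hv : AllSides D v) {i : Fin 3} (hvc : v ∉ corners D)
    (hoc : oppFace v i ∉ corners D) {g o : Site 2} (he : side v i = s(g, o)) {a : Fin nm} (hd : (g, o) ∈ D.stretch a) :
    ObsW D (classWt (basisW q)) v i = ∑ p ∈ outAt a, basisW q p * (patternCount D v i p : ℂ) :=
  obsW_classWt_eq_sum_outAt _ hv hvc hoc he hd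

/-- ★ **every tripod-law observable is a combination of the adapted basis observables of any cut**:
`ObsW D wt v i = Σ_{q ∈ outAt a} wt(q) · ObsW D (classWt (basisWAt a q)) v i` at every admissible edge (not only on the boundary).
[cite: KhristoforovSmirnov2021, §2 Definition 3 and Lemma 4 (arXiv v1 p. 4)] -/
theorem obsW_eq_sum_basisWAt {wt : Fin nm → Finset (Fin nm × Fin nm) → ℂ} (hT : TripodLaw wt) (a : Fin nm) {v : HexVertex}
    (hv : AllSides D v) {i : Fin 3} (hvc : v ∉ corners D) (hoc : oppFace v i ∉ corners D) :
    ObsW D wt v i = ∑ q ∈ outAt a, wt q.1.1 q.1.2 * ObsW D (classWt (basisWAt a q)) v i := by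
  have hw := tripodLaw_iff_restrict_mem_solW.1 hT
  rw [← obsW_classWt_restrictW wt hv hvc hoc, ← obsWLin_apply, ← classWtLin_apply, eq_sum_basisWAt_of_mem_solW a hw, map_sum, map_sum]
  refine Finset.sum_congr rfl fun q _ => ?_
  rw [map_smul, map_smul, smul_eq_mul, classWtLin_apply, obsWLin_apply]
  rfl

end AllArcs

/-! ### Rotating the domain, for pattern weights -/

section DomainRotation

variable {n : ℕ} (D : TriMarkedDomain (n + 2))

/-- ★ for pattern weights: **the observable of `w` on the rotated domain is the observable of `w ∘ σ⁻¹` on the original one**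
(`σ` the rotation of the patterns). [cite: KhristoforovSmirnov2021, §2 Definition 3 (arXiv v1 p. 4); §1.2 (p. 2)] -/
theorem obsW_rotate_classWt (w : Pat (n + 2) → ℂ) (v : HexVertex) (i : Fin 3) :
    ObsW D.rotate (classWt w) v i = ObsW D (classWt (w ∘ patMap (rot (n + 2)).symm isCyc_rot.symm)) v i := by
  rw [obsW_rotate, classWt_comp_patMap]

/-- ★★ **THE ADAPTED BASIS OBSERVABLES OF THE ROTATED DOMAIN ARE THOSE OF THE ORIGINAL DOMAIN, ONE CUT ON** (in the original labels):
`ObsW D.rotate (classWt (basisWAt a q)) = ObsW D (classWt (basisWAt (rot a) (rot q)))` — consistent with the tree's `rotate_stretch`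
(`D.rotate.stretch a = D.stretch (a + 1)`: the arc `A'_a` of the rotated domain is the arc `A_{a+1}` of `D`).
[cite: KhristoforovSmirnov2021, §2 Definition 3 (arXiv v1 p. 4); BollobasRiordan2006, Ch. 7 §7.2.3 p. 197 (re-marking by relabelling; verbatim «follow by relabelling the domain», §7.2.4, proof of Lemma 13)] -/
theorem obsW_rotate_basisWAt (a : Fin (n + 2)) (q : Pat (n + 2)) (v : HexVertex) (i : Fin 3) :
    ObsW D.rotate (classWt (basisWAt a q)) v i =
      ObsW D (classWt (basisWAt (rot (n + 2) a) (patMap (rot (n + 2)) isCyc_rot q))) v i := by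
  rw [obsW_rotate_classWt, basisWAt_comp_patMap_symm isCyc_rot a q]

end DomainRotation

end Literature.Probability.Percolation.MarkedLoops
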